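import Summits.FinalStateConjecture.FinalStateConjecture.Theorems.ZeroEnergyKerrOrBombHawkingExtensionIsKerrLocalZerothLawStar
import HarnessLib

/-!
# Crux `HawkingExtensionIsKerr` (stmt-FinalStateConjecture-17840), line `SketchIdeator2` —
# collar zeroth law, step E3: tangent extensions and the Codazzi-type vanishing

Helper file of the line lead (c3), programme "collar zeroth law" (abstract setting of
`…LocalZerothLawStar`: a global Killing field `K`, a candidate surface gravity `κ̃`, the horizon
`S ⊇ {g(K,K) = 0}` near `x` with the pointwise law).  Every `X ∈ ker df_x` (`f = g(K,K)`) extends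
to a field tangent to all level sets of `f` near `x` (`exists_tangent_extension`); differentiating
`g(∇_Xt K, Zt) = 0` (step E2 along `S`) along the horizon gives
`g(R(W, K) X, Z) = 0` for `W, X, Z ∈ ker df_x` (`riemann_tangent_eq_zero`) — the Codazzi identity
of the totally geodesic null hypersurface `{f = 0}` (Wald 1984, §12.5).
-/

noncomputable section

set_option linter.dupNamespace false

namespace Summit.FinalStateConjecture.FinalStateConjecture.Theorems.HawkingExtensionIsKerr.SketchIdeator2

open Set Function Filter Bundle FiberBundle Literature.Geometry.Lorentzian
open scoped Manifold ContDiff Topology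

section Codazzi

variable {E : Type*} [NormedAddCommGroup E] [NormedSpace ℝ E] [FiniteDimensional ℝ E]
  [CompleteSpace E] {H : Type*} [TopologicalSpace H] {I : ModelWithCorners ℝ E H}
  [I.Boundaryless] {M : Type*} [TopologicalSpace M] [ChartedSpace H M] [IsManifold I ∞ M]
  {g : PseudoRiemannianMetric I ∞ E (TangentSpace I : M → Type _)} [g.HasLeviCivita]
  {K : Π x : M, TangentSpace I x} {κf : M → ℝ}

omit [I.Boundaryless] in
/-- **Tangent extensions.**  For a Killing field `K` with `f = g(K, K)` and `df_x ≠ 0`, every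
`X ∈ ker df_x` extends to a vector field `Xt`, smooth at `x`, with `Xt x = X` and `df(Xt) = 0`
identically near `x` (tangent to all level sets of `f`): `Xt = X̂ - (g(∇_X̂ K, K)/g(∇_V K, K)) V`
for the canonical extensions `X̂`, `V` of `X` and of a vector `v₀` with `df_x(v₀) ≠ 0`. -/
theorem exists_tangent_extension (hK : g.IsKillingField K) {x : M}
    (hdf : mvfderiv I (fun y ↦ g.val y (K y) (K y)) x ≠ 0) {X : TangentSpace I x}
    (hX : mvfderiv I (fun y ↦ g.val y (K y) (K y)) x X = 0) :
    ∃ Xt : Π y : M, TangentSpace I y, CMDiffAt ∞ (T% Xt) x ∧ Xt x = X ∧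
      ∀ᶠ y in 𝓝 x, mvfderiv I (fun z ↦ g.val z (K z) (K z)) y (Xt y) = 0 := by
  -- a vector `v₀` with `df_x(v₀) ≠ 0`
  obtain ⟨v₀, hv₀⟩ : ∃ v₀, mvfderiv I (fun y ↦ g.val y (K y) (K y)) x v₀ ≠ 0 := by
    by_contra h
    push Not at h
    exact hdf (ContinuousLinearMap.ext fun v ↦ by rw [h v]; rfl)
  set V : Π y : M, TangentSpace I y := FiberBundle.extend E v₀ with hVdef
  set Xh : Π y : M, TangentSpace I y := FiberBundle.extend E X with hXhdef
  have hV : CMDiffAt ∞ (T% V) x := contMDiffAt_extend ..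
  have hXh : CMDiffAt ∞ (T% Xh) x := contMDiffAt_extend ..
  have hVx : V x = v₀ := extend_apply_self E v₀
  have hXhx : Xh x = X := extend_apply_self E X
  set a : M → ℝ := fun y ↦ g.val y (g.leviCivita K y (Xh y)) (K y) with hadef
  set b : M → ℝ := fun y ↦ g.val y (g.leviCivita K y (V y)) (K y) with hbdef
  have ha : ContMDiffAt I 𝓘(ℝ, ℝ) ∞ a x :=
    g.contMDiffAt_val_apply le_rfl (contMDiffAt_leviCivita_apply_of_isKillingField hK hXh)
      (hK.contMDiff x)
  have hb : ContMDiffAt I 𝓘(ℝ, ℝ) ∞ b x :=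
    g.contMDiffAt_val_apply le_rfl (contMDiffAt_leviCivita_apply_of_isKillingField hK hV)
      (hK.contMDiff x)
  have hbx' : g.val x (g.leviCivita K x (V x)) (K x) = b x := rfl
  have hax' : g.val x (g.leviCivita K x (Xh x)) (K x) = a x := rfl
  have hbx : b x ≠ 0 := by
    intro hb0
    apply hv₀
    rw [← hVx, hK.mvfderiv_val_self_apply x (V x), hbx', hb0, mul_zero]
  have hax : a x = 0 := by
    have h := hK.mvfderiv_val_self_apply x (Xh x)
    rw [hax', hXhx, hX] at h
    linarith
  set c : M → ℝ := fun y ↦ -(a y / b y) with hcdef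
  have hc : ContMDiffAt I 𝓘(ℝ, ℝ) ∞ c x := (ha.div₀ hb hbx).neg
  refine ⟨Xh + c • V, hXh.add_section (hc.smul_section hV), ?_, ?_⟩
  · change Xh x + c x • V x = X
    have hcx : c x = 0 := by
      change -(a x / b x) = 0
      rw [hax, zero_div, neg_zero]
    rw [hcx, zero_smul, add_zero, hXhx]
  · have hbne : ∀ᶠ y in 𝓝 x, b y ≠ 0 := hb.continuousAt.eventually_ne hbx
    filter_upwards [hbne] with y hy
    have hy' : (Xh + c • V) y = Xh y + c y • V y := rfl
    have hay : g.val y (g.leviCivita K y (Xh y)) (K y) = a y := rfl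
    have hby : g.val y (g.leviCivita K y (V y)) (K y) = b y := rfl
    have hcy : c y = -(a y / b y) := rfl
    rw [hK.mvfderiv_val_self_apply y, hy', map_add, map_smul, map_add, map_smul, add_apply,
      smul_apply, hay, hby, hcy, smul_eq_mul]
    field_simp
    ring

/-- **Step E3: the curvature components `g(R(W, K) X, Z)` with `W, X, Z ∈ ker df_x` vanish**
(a Codazzi-type identity for the totally geodesic null hypersurface `{f = 0}`; Wald 1984, §12.5,
the step from (12.5.24) to (12.5.29)).  Hypotheses as in `star_identity`, now ALONG `S` near `x`
(the level-set property and the pointwise law are local, `κ̃` smooth and non-zero near `x`).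
Proof: for tangent extensions `Xt`, `Zt` of `X`, `Z` the function `G = g(∇_Xt K, Zt)` vanishes on
`S` near `x` by step E2, so `dG_x` kills `W` (step C); expanding with O'Neill's Killing identity,
the two first-order terms vanish by E2 again (the vectors `∇_W Xt`, `∇_W Zt` lie in `ker df_x`,
as `g(K, Xt)`, `g(K, Zt)` vanish on `S`). -/
theorem riemann_tangent_eq_zero (hK : g.IsKillingField K) {S : Set M} {x : M}
    (hκ : ∀ᶠ y in 𝓝 x, ContMDiffAt I 𝓘(ℝ, ℝ) ∞ κf y) (hx : x ∈ S)
    (hlevel : ∀ᶠ y in 𝓝 x, g.val y (K y) (K y) = 0 → y ∈ S)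
    (hS : ∀ᶠ y in 𝓝 x, y ∈ S → g.val y (K y) (K y) = 0 ∧
      ∀ v, g.val y (g.leviCivita K y v) (K y) = -(κf y) * g.val y (K y) v)
    (hkx : κf x ≠ 0) (hKx : K x ≠ 0)
    {W X Z : TangentSpace I x} (hW : mvfderiv I (fun y ↦ g.val y (K y) (K y)) x W = 0)
    (hX : mvfderiv I (fun y ↦ g.val y (K y) (K y)) x X = 0)
    (hZ : mvfderiv I (fun y ↦ g.val y (K y) (K y)) x Z = 0) :
    g.val x (g.riemann x W (K x) X) Z = 0 := by
  have hLC : g.IsLeviCivita g.leviCivita := PseudoRiemannianMetric.isLeviCivita_leviCivita_holds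
  have h2 : (2 : ℕ∞ω) ≤ ∞ := ENat.LEInfty.out
  obtain ⟨hfx, hptx⟩ := hS.self_of_nhds hx
  have hκx : ContMDiffAt I 𝓘(ℝ, ℝ) ∞ κf x := hκ.self_of_nhds
  -- `df_y = -2 κ̃(y) g(K y, ·)` on `S` near `x`
  have hdfS : ∀ᶠ y in 𝓝 x, y ∈ S → ∀ v,
      mvfderiv I (fun z ↦ g.val z (K z) (K z)) y v = -(2 * κf y) * g.val y (K y) v := by
    filter_upwards [hS] with y hy hyS v
    rw [hK.mvfderiv_val_self_apply y v, (hy hyS).2 v]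
    ring
  -- a transverse vector `u₀` with `g(K x, u₀) ≠ 0`, extended; `g(K, U) ≠ 0` and `κ̃ ≠ 0` near `x`
  obtain ⟨u₀, hu₀⟩ : ∃ u₀, g.val x (K x) u₀ ≠ 0 := by
    by_contra h
    push Not at h
    exact hKx (g.nondegenerate x _ h)
  set U : Π y : M, TangentSpace I y := FiberBundle.extend E u₀ with hUdef
  have hU : CMDiffAt ∞ (T% U) x := contMDiffAt_extend ..
  have hUx : U x = u₀ := extend_apply_self E u₀
  have hKU : ∀ᶠ y in 𝓝 x, g.val y (K y) (U y) ≠ 0 := by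
    have hc : ContMDiffAt I 𝓘(ℝ, ℝ) ∞ (fun y ↦ g.val y (K y) (U y)) x :=
      g.contMDiffAt_val_apply le_rfl (hK.contMDiff x) hU
    exact hc.continuousAt.eventually_ne (by rwa [hUx])
  have hkne : ∀ᶠ y in 𝓝 x, κf y ≠ 0 := hκx.continuousAt.eventually_ne hkx
  -- hence `df ≠ 0` on `S` near `x`
  have hdfx : mvfderiv I (fun y ↦ g.val y (K y) (K y)) x ≠ 0 := by
    intro h0
    have h := hdfS.self_of_nhds hx u₀
    rw [h0] at h
    simp only [zero_apply] at h
    exact hu₀ ((mul_eq_zero.mp h.symm).resolve_left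
      (neg_ne_zero.mpr (mul_ne_zero two_ne_zero hkx)))
  -- the hypotheses of step E2 hold at every point of `S` near `x`
  have hE2 : ∀ᶠ y in 𝓝 x, y ∈ S → ∀ X' Z' : TangentSpace I y,
      mvfderiv I (fun z ↦ g.val z (K z) (K z)) y X' = 0 →
      mvfderiv I (fun z ↦ g.val z (K z) (K z)) y Z' = 0 →
      g.val y (g.leviCivita K y X') Z' = 0 := by
    filter_upwards [hκ, hlevel.eventually_nhds, hS.eventually_nhds, hKU, hkne, hdfS]
      with y hκy hly hSy hKUy hky hdfy hyS X' Z' hX' hZ'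
    have hdfy' : mvfderiv I (fun z ↦ g.val z (K z) (K z)) y ≠ 0 := by
      intro h0
      have h := hdfy hyS (U y)
      rw [h0] at h
      simp only [zero_apply] at h
      exact hKUy ((mul_eq_zero.mp h.symm).resolve_left
        (neg_ne_zero.mpr (mul_ne_zero two_ne_zero hky)))
    exact secondFF_eq_zero hK hκy hyS hly hSy hdfy' hky hX' hZ'
  -- tangent extensions of `X` and `Z`
  obtain ⟨Xt, hXt, hXtx, hXtker⟩ := exists_tangent_extension hK hdfx hX
  obtain ⟨Zt, hZt, hZtx, hZtker⟩ := exists_tangent_extension hK hdfx hZ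
  -- `G = g(∇_Xt K, Zt)` and `h = g(K, Xt)`, `h' = g(K, Zt)` vanish on `S` near `x`
  have hGS : ∀ᶠ y in 𝓝 x, y ∈ S → g.val y (g.leviCivita K y (Xt y)) (Zt y) = 0 := by
    filter_upwards [hE2, hXtker, hZtker] with y hy hXy hZy hyS
    exact hy hyS (Xt y) (Zt y) hXy hZy
  have hKtS : ∀ {T : Π y : M, TangentSpace I y},
      (∀ᶠ y in 𝓝 x, mvfderiv I (fun z ↦ g.val z (K z) (K z)) y (T y) = 0) →
      ∀ᶠ y in 𝓝 x, y ∈ S → g.val y (K y) (T y) = 0 := by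
    intro T hT
    filter_upwards [hT, hdfS, hkne] with y hTy hdfy hky hyS
    have h := hdfy hyS (T y)
    rw [hTy] at h
    exact (mul_eq_zero.mp h.symm).resolve_left (neg_ne_zero.mpr (mul_ne_zero two_ne_zero hky))
  -- regularity at `x`
  have hKxs : CMDiffAt ∞ (T% K) x := hK.contMDiff x
  have hA : CMDiffAt ∞ (T% (fun y ↦ g.leviCivita K y (Xt y))) x :=
    contMDiffAt_leviCivita_apply_of_isKillingField hK hXt
  have hf1 : ContMDiffAt I 𝓘(ℝ, ℝ) ∞ (fun y ↦ g.val y (K y) (K y)) x :=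
    g.contMDiffAt_val_apply le_rfl hKxs hKxs
  have hG1 : ContMDiffAt I 𝓘(ℝ, ℝ) ∞ (fun y ↦ g.val y (g.leviCivita K y (Xt y)) (Zt y)) x :=
    g.contMDiffAt_val_apply le_rfl hA hZt
  -- step C for `G`, `h`, `h'`
  have hCzero : ∀ {F : M → ℝ}, (∀ᶠ y in 𝓝 x, y ∈ S → F y = 0) →
      ∀ᶠ y in 𝓝 x, g.val y (K y) (K y) = g.val x (K x) (K x) → F y = F x := by
    intro F hF
    filter_upwards [hlevel, hF] with y hly hFy hfy
    rw [hfx] at hfy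
    rw [hF.self_of_nhds hx, hFy (hly hfy)]
  have hdG : mvfderiv I (fun y ↦ g.val y (g.leviCivita K y (Xt y)) (Zt y)) x W = 0 :=
    mvfderiv_apply_eq_zero_of_levelSet (hf1.of_le ENat.LEInfty.out) (hG1.of_le ENat.LEInfty.out)
      (hCzero hGS) hdfx hW
  have hdh : mvfderiv I (fun y ↦ g.val y (K y) (Xt y)) x W = 0 :=
    mvfderiv_apply_eq_zero_of_levelSet (hf1.of_le ENat.LEInfty.out)
      ((g.contMDiffAt_val_apply le_rfl hKxs hXt).of_le ENat.LEInfty.out) (hCzero (hKtS hXtker))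
      hdfx hW
  have hdh' : mvfderiv I (fun y ↦ g.val y (K y) (Zt y)) x W = 0 :=
    mvfderiv_apply_eq_zero_of_levelSet (hf1.of_le ENat.LEInfty.out)
      ((g.contMDiffAt_val_apply le_rfl hKxs hZt).of_le ENat.LEInfty.out) (hCzero (hKtS hZtker))
      hdfx hW
  -- expand the three derivatives along the extension `Wf` of `W`
  set Wf : Π y : M, TangentSpace I y := FiberBundle.extend E W with hWfdef
  have hWf : MDiffAt (T% Wf) x := mdifferentiableAt_extend ..
  have hWfx : Wf x = W := extend_apply_self E W
  have hKd : MDiffAt (T% K) x := hK.mdifferentiableAt x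
  have hXtd : MDiffAt (T% Xt) x := hXt.mdifferentiableAt (by simp)
  have hZtd : MDiffAt (T% Zt) x := hZt.mdifferentiableAt (by simp)
  have hAd : MDiffAt (T% (fun y ↦ g.leviCivita K y (Xt y))) x := hA.mdifferentiableAt (by simp)
  have hcG := hLC.2 hWf hAd hZtd
  have hch := hLC.2 hWf hKd hXtd
  have hch' := hLC.2 hWf hKd hZtd
  rw [hWfx] at hcG hch hch'
  rw [hcG, hXtx, hZtx] at hdG
  rw [hch, hXtx] at hdh
  rw [hch', hZtx] at hdh'
  -- O'Neill Ch. 9 Ex. 8 for the field `Xt`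
  have h8 := hK.leviCivita₂_eq_riemann h2 hXtd W
  rw [hXtx] at h8
  have h8' : g.leviCivita (fun y ↦ g.leviCivita K y (Xt y)) x W =
      g.riemann x W (K x) X + g.leviCivita K x (g.leviCivita Xt x W) := by
    rw [← h8]; abel
  rw [h8', map_add, add_apply] at hdG
  -- step E2 at `x`
  have hE2x := hE2.self_of_nhds hx
  have hBWX : g.val x (g.leviCivita K x W) X = 0 := hE2x W X hW hX
  have hBWZ : g.val x (g.leviCivita K x W) Z = 0 := hE2x W Z hW hZ
  -- `u = ∇_W Xt` and `u' = ∇_W Zt` lie in `ker df_x`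
  have hdfxv : ∀ v, mvfderiv I (fun z ↦ g.val z (K z) (K z)) x v = -(2 * κf x) * g.val x (K x) v :=
    hdfS.self_of_nhds hx
  have hu : mvfderiv I (fun z ↦ g.val z (K z) (K z)) x (g.leviCivita Xt x W) = 0 := by
    rw [hdfxv]
    have : g.val x (K x) (g.leviCivita Xt x W) = 0 := by linarith
    rw [this, mul_zero]
  have hu' : mvfderiv I (fun z ↦ g.val z (K z) (K z)) x (g.leviCivita Zt x W) = 0 := by
    rw [hdfxv]
    have : g.val x (K x) (g.leviCivita Zt x W) = 0 := by linarith
    rw [this, mul_zero]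
  -- the two first-order terms vanish by E2
  have hT2 : g.val x (g.leviCivita K x (g.leviCivita Xt x W)) Z = 0 := by
    have hB := hE2x Z (g.leviCivita Xt x W) hZ hu
    have hKill := hK.val_leviCivita_add x (g.leviCivita Xt x W) Z
    rw [g.symm x (g.leviCivita Xt x W) (g.leviCivita K x Z), hB, add_zero] at hKill
    exact hKill
  have hT3 : g.val x (g.leviCivita K x X) (g.leviCivita Zt x W) = 0 := hE2x X _ hX hu'
  linarith

end Codazzi

/-- **Registered sub-goal form of step E3** (closed statement over `E4`-charted manifolds, crux
stmt-FinalStateConjecture-17840): the curvature components `g(R(W,K)X, Z)`, `W, X, Z ∈ K^⊥`,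
vanish along the horizon where `κ̃ ≠ 0`. -/
theorem stub_riemann_tangent_eq_zero : ∀ (M : Type) [TopologicalSpace M] [ChartedSpace E4 M] [IsManifold (𝓡 4) ∞ M] (g : PseudoRiemannianMetric (𝓡 4) ∞ E4 (TangentSpace (𝓡 4) : M → Type _)) [g.HasLeviCivita] (K : Π x : M, TangentSpace (𝓡 4) x) (κf : M → ℝ) (S : Set M) (x : M), g.IsKillingField K → (∀ᶠ y in 𝓝 x, ContMDiffAt (𝓡 4) 𝓘(ℝ, ℝ) ∞ κf y) → x ∈ S → (∀ᶠ y in 𝓝 x, g.val y (K y) (K y) = 0 → y ∈ S) → (∀ᶠ y in 𝓝 x, y ∈ S → g.val y (K y) (K y) = 0 ∧ ∀ v, g.val y (g.leviCivita K y v) (K y) = -(κf y) * g.val y (K y) v) → κf x ≠ 0 → K x ≠ 0 → ∀ W X Z : TangentSpace (𝓡 4) x, mvfderiv (𝓡 4) (fun y ↦ g.val y (K y) (K y)) x W = 0 → mvfderiv (𝓡 4) (fun y ↦ g.val y (K y) (K y)) x X = 0 → mvfderiv (𝓡 4) (fun y ↦ g.val y (K y) (K y)) x Z = 0 → g.val x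 (g.riemann x W (K x) X) Z = 0 :=
  fun _ _ _ _ _ _ _ _ _ _ hK hκ hx hlevel hS hkx hKx _ _ _ hW hX hZ ↦
    riemann_tangent_eq_zero hK hκ hx hlevel hS hkx hKx hW hX hZ

end Summit.FinalStateConjecture.FinalStateConjecture.Theorems.HawkingExtensionIsKerr.SketchIdeator2

end
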